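import Mathlib
import Summits.HodgeConjecture.FermatCycles.HodgeFermatPropZ5A

/-!
# PROPOSITION Z5 (`tables/KR-FREE.md` §6) — part 2: `propZ5` (`HodgeFermat/PropZ5.lean`; HF-G21a)

Tree copy (part 2 of 2) of the module `HodgeFermat/PropZ5.lean` of the sibling cell's standalone package
`run/shared/lean/pub/pub-hodgefermat/lean/HodgeFermat/` (616 lines, sha256 `01180db7a7a8c945…`), source lines 299–616 (§§5–7: the window argument, `half_case`, PROPOSITION Z5 `propZ5`, `Z1_unit_rigid`).
Filed by cell `pub-hfermat`, seat prover-1 gen-3, on the COORDINATOR KEEPER RULING of 2026-08-25 (gem sweep H1: take the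
off-gate kernel theorem `thmFstar` through the gate) — here THEOREM F* of `tables/DPRIME-THEOREM.md` §9 IN FULL, i.e.
PROPOSITION D′(3N) and the descent (`HodgeFermat/PropDPrimeNFinal.lean`, GATE HF-G34), the last off-gate form of THEOREM F*
(its first two forms, `DecodingFinal.thmFstar` = F* at the prime levels and `ThmFstarNFinal.thmFstar` = F*(3N), landed on
2026-08-25 as `HodgeFermatThmFstar.lean` / `HodgeFermatThmFstarN.lean`, seats prover-1 gen-0 / gen-2); this file is one link of
the import closure of `PropDPrimeNFinal.propDprime` (the sibling's KR-free chain: THEOREM L, COROLLARY M, THEOREM D6,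
THEOREM U⁺, THEOREM KR6, THEOREM Z3U) on top of those landed chains.  The source module is the sibling's hub-checked module of
record (pub-hodgefermat `CERT.md` l.867, GATE HF-G21a; cell record `check/PropZ5_standalone.lean` sha256 `120809aa4f833e51…`); its declarations are copied VERBATIM.
Deviations from the source module, exhaustively: the `import` lines (tree modules `Summits.HodgeConjecture.FermatCycles.
HodgeFermat*` instead of `HodgeFermat.*`); this module docstring; the `set_option`/namespace/`open` preamble (source l.43–47, with the `open … PropL5` line as in part 1) and part 1's two re-binding `open` lines are repeated at the top because the module is split. The module docstring is quoted in full in part 1.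
Every other line — in particular every declaration's statement and proof — is byte-identical to the source.
HONEST FRAMING: explicit algebraic cycles for specific Hodge classes on Fermat/Delsarte varieties; residual open instances
listed; no claim on general Hodge.  (This file is arithmetic of CM types / finite combinatorics / analytic number theory
of the sibling's KR-free programme; it claims nothing about cycles.)
-/

set_option autoImplicit false

namespace HodgeFermat.KRFree.PropZ5

open HodgeFermat.KRFree.PropL5

open HodgeFermat.KRFree.TheoremUEq renaming not_dvd_unit → not_dvd_of_coprime
open HodgeFermat.KRFree.Decoding renaming unit_mul_not_dvd → not_dvd_mul_of_coprime

/-! ## The window argument (`KR-FREE` §6, last paragraph) -/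

/-- `⟨2S⟩_N` for `S < N`: either `2S` or `2S − N` -/
lemma two_mul_mod_cases {S N : ℕ} (hS : S < N) : 2 * S % N = 2 * S ∨ 2 * S % N + N = 2 * S := by
  by_cases h : 2 * S < N
  · exact Or.inl (Nat.mod_eq_of_lt h)
  · right
    have := mod_eq_of_repr (x := 2 * S) (m := N) (q := 1) (r := 2 * S - N) (by omega) (by omega)
    omega

/-- `1 ∉ H_T` and `2 ∉ H_T` for `T = (5, N − a, ·)`, `1 ≤ a ≤ 4` (carries `2`: `5 + (N − a) > N`,
`10 + (N − 2a) > N`) -/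
lemma one_two_not_inH (n a c : ℕ) (hn : 2 < n) (ha1 : 1 ≤ a) (ha4 : a ≤ 4) :
    ¬ InH (5 * n) (5, 5 * n - a, c) 1 ∧ ¬ InH (5 * n) (5, 5 * n - a, c) 2 := by
  have e1 : 1 * 5 % (5 * n) = 5 := by rw [Nat.one_mul]; exact Nat.mod_eq_of_lt (by omega)
  have e2 : 1 * (5 * n - a) % (5 * n) = 5 * n - a := by
    rw [Nat.one_mul]; exact Nat.mod_eq_of_lt (by omega)
  have e3 : 2 * 5 % (5 * n) = 10 := Nat.mod_eq_of_lt (by omega)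
  have e4 : 2 * (5 * n - a) % (5 * n) = 5 * n - 2 * a :=
    mod_eq_of_repr (q := 1) (by omega) (by omega)
  constructor
  · show ¬ (1 * 5 % (5 * n) + 1 * (5 * n - a) % (5 * n) < 5 * n)
    rw [e1, e2]; omega
  · show ¬ (2 * 5 % (5 * n) + 2 * (5 * n - a) % (5 * n) < 5 * n)
    rw [e3, e4]; omega

/-- **The window.**  `N = 5n`, `n > 5`; `T' = (r', s', t')` of level `N` with `⟨r'⟩_N = (N + 5)/2`, `5 ∤ s' t'`
and (†) `⟨s'⟩_n + ⟨t'⟩_n = (n − 5)/2`.  Then `1 ∉ H_{T'}` and `2 ∉ H_{T'}` cannot both hold: they force one of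
`⟨s'⟩_N, ⟨t'⟩_N` into `{N − 2, N − 1}`, whose residue mod `n` is `≥ n − 2 > (n − 5)/2`. -/
theorem window (n r' s' t' : ℕ) (hn : 5 < n) (hsum : 5 * n ∣ r' + s' + t')
    (hr' : 2 * (r' % (5 * n)) = 5 * n + 5) (h5s' : ¬ 5 ∣ s') (h5t' : ¬ 5 ∣ t')
    (hdag : 2 * (s' % n + t' % n) + 5 = n)
    (h1 : ¬ InH (5 * n) (r', s', t') 1) (h2 : ¬ InH (5 * n) (r', s', t') 2) : False := by
  have hN : 0 < 5 * n := by omega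
  have hn0 : 0 < n := by omega
  have fnd : ∀ {u v : ℕ}, ¬ 5 ∣ u → ¬ 5 ∣ v → ¬ 5 * n ∣ u * v :=
    fun hu hv h => five_nd hu hv (Nat.dvd_trans ⟨n, rfl⟩ h)
  have h51 : ¬ 5 ∣ 1 := by omega
  have h52 : ¬ 5 ∣ 2 := by omega
  have hR2 : 2 * r' % (5 * n) = 5 := by
    have h := Nat.mul_mod 2 r' (5 * n)
    rw [Nat.mod_eq_of_lt (show 2 < 5 * n by omega)] at h
    rw [h]
    exact mod_eq_of_repr (q := 1) (by omega) (by omega)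
  have hr1 : ¬ 5 * n ∣ 1 * r' := by
    intro h
    have := Nat.mod_eq_zero_of_dvd h
    rw [Nat.one_mul] at this
    omega
  have hr2 : ¬ 5 * n ∣ 2 * r' := by
    intro h
    have := Nat.mod_eq_zero_of_dvd h
    omega
  have c1 : rsum (5 * n) (r', s', t') 1 = 2 * (5 * n) := by
    rcases rsum_cases hN hsum hr1 (fnd h51 h5s') (fnd h51 h5t') with h | h
    · exact absurd ((inH_iff_rsum hN hsum hr1 (fnd h51 h5s') (fnd h51 h5t')).mpr h) h1
    · exact h
  have c2 : rsum (5 * n) (r', s', t') 2 = 2 * (5 * n) := by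
    rcases rsum_cases hN hsum hr2 (fnd h52 h5s') (fnd h52 h5t') with h | h
    · exact absurd ((inH_iff_rsum hN hsum hr2 (fnd h52 h5s') (fnd h52 h5t')).mpr h) h2
    · exact h
  have c1' : r' % (5 * n) + s' % (5 * n) + t' % (5 * n) = 2 * (5 * n) := by
    have h := c1
    unfold rsum at h
    simp only [Nat.one_mul] at h
    exact h
  have c2' : 5 + 2 * s' % (5 * n) + 2 * t' % (5 * n) = 2 * (5 * n) := by
    have h := c2
    unfold rsum at h
    simp only at h
    rw [hR2] at h
    exact h
  clear c1 c2 hr1 hr2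
  have h2s := Nat.mul_mod 2 s' (5 * n)
  have h2t := Nat.mul_mod 2 t' (5 * n)
  rw [Nat.mod_eq_of_lt (show 2 < 5 * n by omega)] at h2s h2t
  have bS : s' % (5 * n) < 5 * n := Nat.mod_lt _ hN
  have bU : t' % (5 * n) < 5 * n := Nat.mod_lt _ hN
  have bS2 : 2 * (s' % (5 * n)) % (5 * n) < 5 * n := Nat.mod_lt _ hN
  have bU2 : 2 * (t' % (5 * n)) % (5 * n) < 5 * n := Nat.mod_lt _ hN
  have cS := two_mul_mod_cases bS
  have cU := two_mul_mod_cases bU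
  have hSU : 5 * n ≤ s' % (5 * n) + 2 ∨ 5 * n ≤ t' % (5 * n) + 2 := by omega
  have eS : n * (s' % (5 * n) / n) + s' % n = s' % (5 * n) := by
    have := Nat.div_add_mod (s' % (5 * n)) n
    rwa [Nat.mod_mul_left_mod] at this
  have eU : n * (t' % (5 * n) / n) + t' % n = t' % (5 * n) := by
    have := Nat.div_add_mod (t' % (5 * n)) n
    rwa [Nat.mod_mul_left_mod] at this
  have qS : s' % (5 * n) / n < 5 := (Nat.div_lt_iff_lt_mul hn0).mpr bS
  have qU : t' % (5 * n) / n < 5 := (Nat.div_lt_iff_lt_mul hn0).mpr bU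
  have bs : s' % n < n := Nat.mod_lt _ hn0
  have bt : t' % n < n := Nat.mod_lt _ hn0
  obtain ⟨QS, hQS⟩ : ∃ Q, Q = s' % (5 * n) / n := ⟨_, rfl⟩
  obtain ⟨QU, hQU⟩ : ∃ Q, Q = t' % (5 * n) / n := ⟨_, rfl⟩
  rw [← hQS] at eS qS
  rw [← hQU] at eU qU
  rcases hSU with h | h
  · interval_cases QS <;> omega
  · interval_cases QU <;> omega

/-! ## PROPOSITION Z5 -/

/-- `2u ≡ 1 (mod n)` means `⟨u⟩_n = (n + 1)/2` -/
lemma two_inv {n u : ℕ} (hn : 1 < n) (h : 2 * u % n = 1) : 2 * (u % n) = n + 1 := by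
  have h1 : 2 * (u % n) % n = 1 := by rw [mul_mod_mod]; exact h
  have h2 := Nat.div_add_mod (2 * (u % n)) n
  rw [h1] at h2
  have hb : u % n < n := Nat.mod_lt _ (by omega)
  have hq : 2 * (u % n) / n < 2 := (Nat.div_lt_iff_lt_mul (by omega)).mpr (by omega)
  obtain ⟨q, hq'⟩ : ∃ q, q = 2 * (u % n) / n := ⟨_, rfl⟩
  rw [← hq'] at h2 hq
  interval_cases q <;> omega

/-- the case `ȳ' = 2̄⁻¹` of PROPOSITION Z5 for a normalised pair `T = (5, s, t)`, `T' = (5y', s', t')`: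
(E) at `1̄` ⇒ `T ≡ (5, N − a, N − b)` after the second normalisation and (†) for `T'` ⇒ the window ⇒ absurd -/
theorem half_case (n y' s t s' t' : ℕ) (hn : 20 < n) (h5n : ¬ 5 ∣ n) (hodd : ¬ 2 ∣ n)
    (hs : 5 * n ∣ 5 + s + t) (h5s : ¬ 5 ∣ s) (h5t : ¬ 5 ∣ t)
    (hy' : Nat.Coprime y' n) (hs' : 5 * n ∣ 5 * y' + s' + t') (h5s' : ¬ 5 ∣ s') (h5t' : ¬ 5 ∣ t')
    (hw : 2 * (y' % n) = n + 1)
    (hH : SameType (5 * n) (5, s, t) (5 * y', s', t')) : False := by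
  have hn0 : 0 < n := by omega
  -- (E) at `1̄`: the carry of `T̄` at `1̄` is 2, so `⟨s⟩_n = n − a`, `⟨t⟩_n = n − b`, `a + b = 5`
  obtain ⟨hc2, -⟩ := carries_at_one n y' s t s' t' (by omega) h5n hs h5s h5t hy' hs' h5s' h5t' hw hH
  have hmods : s % n < n := Nat.mod_lt _ hn0
  have hmodt : t % n < n := Nat.mod_lt _ hn0
  have ha1 : 1 ≤ n - s % n := by omega
  have ha4 : n - s % n ≤ 4 := by omega
  -- second normalisation: `u₁ ≡ 1 (mod n)`, `u₁ s ≡ N − a (mod N)`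
  obtain ⟨u₁, hu₁, hu₁5, hu₁s⟩ := norm2 n s (n - s % n) (by omega) h5n h5s ha1 ha4 (by omega)
  have h5u₁ := not_five_dvd_of_coprime hu₁
  have he : u₁ * (5 * y') ≡ 5 * (u₁ * y') [MOD 5 * n] := by
    rw [show u₁ * (5 * y') = 5 * (u₁ * y') by ring]
  have hS2 : SameType (5 * n) (5, 5 * n - (n - s % n), u₁ * t) (5 * (u₁ * y'), u₁ * s', u₁ * t') :=
    sameType_congr_right he (Nat.ModEq.refl _) (sameType_congr_left hu₁5 hu₁s (sameType_scale hu₁ hH))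
  -- the new pair satisfies the same hypotheses
  have hy'' : Nat.Coprime (u₁ * y') n :=
    Nat.Coprime.mul_left (Nat.Coprime.coprime_mul_left_right hu₁) hy'
  have hu₁n : u₁ ≡ 1 [MOD n] := by
    have h : u₁ * 5 ≡ 1 * 5 [MOD n * 5] := by rw [Nat.one_mul, Nat.mul_comm n 5]; exact hu₁5
    exact Nat.ModEq.mul_right_cancel' (by norm_num) h
  have hw'' : 2 * (u₁ * y' % n) = n + 1 := by
    have h : u₁ * y' % n = y' % n := by
      have := hu₁n.mul_right y'
      rw [Nat.one_mul] at this
      exact this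
    rw [h]; exact hw
  have hsum2 : 5 * n ∣ 5 + (5 * n - (n - s % n)) + u₁ * t := by
    have h : 5 * n ∣ u₁ * 5 + u₁ * s + u₁ * t := by
      rw [← mul_add, ← mul_add]; exact Dvd.dvd.mul_left hs u₁
    have e : 5 + (5 * n - (n - s % n)) + u₁ * t ≡ u₁ * 5 + u₁ * s + u₁ * t [MOD 5 * n] :=
      (hu₁5.symm.add hu₁s.symm).add_right _
    exact Nat.modEq_zero_iff_dvd.mp (e.trans (Nat.modEq_zero_iff_dvd.mpr h))
  have hsum2' : 5 * n ∣ 5 * (u₁ * y') + u₁ * s' + u₁ * t' := by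
    rw [show 5 * (u₁ * y') = u₁ * (5 * y') by ring, ← mul_add, ← mul_add]
    exact Dvd.dvd.mul_left hs' u₁
  have h5a : ¬ 5 ∣ 5 * n - (n - s % n) := by omega
  have h5t₁ : ¬ 5 ∣ u₁ * t := five_nd h5u₁ h5t
  have h5s'' : ¬ 5 ∣ u₁ * s' := five_nd h5u₁ h5s'
  have h5t'' : ¬ 5 ∣ u₁ * t' := five_nd h5u₁ h5t'
  -- (†) for the new `T'`
  obtain ⟨-, hdag⟩ := carries_at_one n (u₁ * y') (5 * n - (n - s % n)) (u₁ * t) (u₁ * s') (u₁ * t')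
    (by omega) h5n hsum2 h5a h5t₁ hy'' hsum2' h5s'' h5t'' hw'' hS2
  -- `1, 2 ∉ H_T`, hence `1, 2 ∉ H_{T'}`
  obtain ⟨h1, h2⟩ := one_two_not_inH n (n - s % n) (u₁ * t) (by omega) ha1 ha4
  have hco1 : Nat.Coprime 1 (5 * n) := Nat.coprime_one_left _
  have hco2 : Nat.Coprime 2 (5 * n) := (Nat.Prime.coprime_iff_not_dvd Nat.prime_two).mpr (by omega)
  have h1' : ¬ InH (5 * n) (5 * (u₁ * y'), u₁ * s', u₁ * t') 1 := fun h => h1 ((hS2 1 hco1).mpr h)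
  have h2' : ¬ InH (5 * n) (5 * (u₁ * y'), u₁ * s', u₁ * t') 2 := fun h => h2 ((hS2 2 hco2).mpr h)
  -- the first residue of `T'` is `(N + 5)/2`
  have hr' : 2 * (5 * (u₁ * y') % (5 * n)) = 5 * n + 5 := by
    rw [Nat.mul_mod_mul_left]; omega
  exact window n (5 * (u₁ * y')) (u₁ * s') (u₁ * t') (by omega) hsum2' hr' h5s'' h5t'' hdag h1' h2'

/-- **PROPOSITION Z5** (`tables/KR-FREE.md` §6; the pattern (Z1, Z1) at the prime 5, which Koblitz–Rohrlich's
Case 3, p. 1197, settles by "the Lemma" of p. 1195 whose proof is omitted there — here the DIGIT LEMMA of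
`DigitLemma.lean`).  Level `N = 5n` with `n > 20` prime to 30.  Let `T = (x₁, x₂, x₃)` and `T' = (y₁, y₂, y₃)` be
triples of level `N` (`N ∣` the entry sums), both of pattern Z1 at 5 with unit cofactors — `5 ∣ x₁`, `5 ∣ y₁`,
`gcd(x₁, n) = gcd(y₁, n) = 1`, `5 ∤ x₂ x₃ y₂ y₃` — and with `x₁ ≢ y₁ (mod N)` (which holds when `T`, `T'` are
disjoint, the entries divisible by 5 being `x₁` and `y₁` only).  Then `T` and `T'` do NOT have the same CM type. -/
theorem propZ5 (n x₁ x₂ x₃ y₁ y₂ y₃ : ℕ) (hn : 20 < n) (hn30 : Nat.Coprime n 30)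
    (hX : 5 * n ∣ x₁ + x₂ + x₃) (hx₁ : 5 ∣ x₁) (hx₁n : Nat.Coprime x₁ n) (hx₂ : ¬ 5 ∣ x₂) (hx₃ : ¬ 5 ∣ x₃)
    (hY : 5 * n ∣ y₁ + y₂ + y₃) (hy₁ : 5 ∣ y₁) (hy₁n : Nat.Coprime y₁ n) (hy₂ : ¬ 5 ∣ y₂) (hy₃ : ¬ 5 ∣ y₃)
    (hne : ¬ x₁ ≡ y₁ [MOD 5 * n])
    (hH : SameType (5 * n) (x₁, x₂, x₃) (y₁, y₂, y₃)) : False := by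
  have hn0 : 0 < n := by omega
  have hc2 : Nat.Coprime 2 n := (Nat.Coprime.coprime_dvd_right (by norm_num : 2 ∣ 30) hn30).symm
  have hc5 : Nat.Coprime 5 n := (Nat.Coprime.coprime_dvd_right (by norm_num : 5 ∣ 30) hn30).symm
  have h5n : ¬ 5 ∣ n := (Nat.Prime.coprime_iff_not_dvd Nat.prime_five).mp hc5
  have h2n : ¬ 2 ∣ n := (Nat.Prime.coprime_iff_not_dvd Nat.prime_two).mp hc2
  -- first normalisation: `u₀ x₁ ≡ 5`; then `u₀ y₁ = 5 y'` with `y' = u₀ k`, `y₁ = 5k`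
  obtain ⟨u₀, hu₀, hu₀x⟩ := norm1 n x₁ (by omega) h5n hx₁ hx₁n
  have h5u₀ := not_five_dvd_of_coprime hu₀
  have hu₀n : Nat.Coprime u₀ n := Nat.Coprime.coprime_mul_left_right hu₀
  obtain ⟨k, rfl⟩ := hy₁
  have hkn : Nat.Coprime k n := Nat.Coprime.coprime_mul_left hy₁n
  have hy' : Nat.Coprime (u₀ * k) n := Nat.Coprime.mul_left hu₀n hkn
  have he : u₀ * (5 * k) ≡ 5 * (u₀ * k) [MOD 5 * n] := by
    rw [show u₀ * (5 * k) = 5 * (u₀ * k) by ring]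
  have hS : SameType (5 * n) (5, u₀ * x₂, u₀ * x₃) (5 * (u₀ * k), u₀ * y₂, u₀ * y₃) :=
    sameType_congr_right he (Nat.ModEq.refl _)
      (sameType_congr_left hu₀x (Nat.ModEq.refl _) (sameType_scale hu₀ hH))
  have hsum : 5 * n ∣ 5 + u₀ * x₂ + u₀ * x₃ := by
    have h : 5 * n ∣ u₀ * x₁ + (u₀ * x₂ + u₀ * x₃) := by
      rw [← mul_add, ← mul_add, ← add_assoc]; exact Dvd.dvd.mul_left hX u₀
    have e : 5 + (u₀ * x₂ + u₀ * x₃) ≡ u₀ * x₁ + (u₀ * x₂ + u₀ * x₃) [MOD 5 * n] :=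
      hu₀x.symm.add_right _
    rw [add_assoc]
    exact Nat.modEq_zero_iff_dvd.mp (e.trans (Nat.modEq_zero_iff_dvd.mpr h))
  have hsum' : 5 * n ∣ 5 * (u₀ * k) + u₀ * y₂ + u₀ * y₃ := by
    rw [show 5 * (u₀ * k) = u₀ * (5 * k) by ring, ← mul_add, ← mul_add]
    exact Dvd.dvd.mul_left hY u₀
  have h5s : ¬ 5 ∣ u₀ * x₂ := five_nd h5u₀ hx₂
  have h5t : ¬ 5 ∣ u₀ * x₃ := five_nd h5u₀ hx₃
  have h5s' : ¬ 5 ∣ u₀ * y₂ := five_nd h5u₀ hy₂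
  have h5t' : ¬ 5 ∣ u₀ * y₃ := five_nd h5u₀ hy₃
  -- `w = ȳ' = (u₀ k) mod n` is a unit of `ℤ/n` other than 1
  have hw_lt : u₀ * k % n < n := Nat.mod_lt _ hn0
  have hw_co : Nat.Coprime (u₀ * k % n) n := by
    unfold Nat.Coprime
    rw [← Nat.gcd_rec]
    exact hy'.symm
  have hw1 : u₀ * k % n ≠ 1 := by
    intro h1
    apply hne
    have e1 : u₀ * (5 * k) ≡ 5 [MOD 5 * n] := by
      unfold Nat.ModEq
      rw [show u₀ * (5 * k) = 5 * (u₀ * k) by ring, Nat.mul_mod_mul_left, h1, Nat.mul_one,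
        Nat.mod_eq_of_lt (show 5 < 5 * n by omega)]
    exact Nat.ModEq.cancel_left_of_coprime hu₀.symm (hu₀x.trans e1.symm)
  have hw2 : 1 < u₀ * k % n := by
    have h0 : u₀ * k % n ≠ 0 := by
      intro h0
      have h := hw_co
      rw [h0] at h
      have := (Nat.coprime_zero_left n).mp h
      omega
    omega
  -- the digit hypothesis, and the DIGIT LEMMA: `w = 2` or `w = 2⁻¹`
  have hDC : DigitClose n (u₀ * k % n) :=
    digitClose_of_sameType n (u₀ * k) _ _ _ _ (by omega) h5n hsum h5s h5t hy' hsum' h5s' h5t' hS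
  rcases digit_lemma hn hn30 hw2 hw_lt hw_co hDC with hw | hw
  · -- `w = 2`: interchange `T` and `T'` and renormalise; the new `w` is `2⁻¹`
    obtain ⟨u, hu, hu5⟩ :=
      norm1 n (5 * (u₀ * k)) (by omega) h5n ⟨u₀ * k, rfl⟩ (Nat.Coprime.mul_left hc5 hy')
    have h5u := not_five_dvd_of_coprime hu
    have hun : Nat.Coprime u n := Nat.Coprime.coprime_mul_left_right hu
    have hT : SameType (5 * n) (5, u * (u₀ * y₂), u * (u₀ * y₃))
        (5 * u, u * (u₀ * x₂), u * (u₀ * x₃)) :=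
      sameType_congr_right (by rw [Nat.mul_comm u 5]) (Nat.ModEq.refl _)
        (sameType_congr_left hu5 (Nat.ModEq.refl _) (sameType_scale hu (sameType_symm hS)))
    -- `2 u ≡ u ȳ' ≡ 1 (mod n)`
    have huinv : u * (u₀ * k) ≡ 1 [MOD n] := by
      have h : u * (u₀ * k) * 5 ≡ 1 * 5 [MOD n * 5] := by
        rw [show u * (u₀ * k) * 5 = u * (5 * (u₀ * k)) by ring, Nat.one_mul, Nat.mul_comm n 5]
        exact hu5
      exact Nat.ModEq.mul_right_cancel' (by norm_num) h
    have hw' : 2 * (u % n) = n + 1 := by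
      apply two_inv (by omega)
      have h : 2 * u % n = u * (u₀ * k) % n := by
        rw [Nat.mul_comm 2 u, ← mul_mod_mod u (u₀ * k) n, hw]
      rw [h]
      have := huinv
      unfold Nat.ModEq at this
      rw [this]
      exact Nat.mod_eq_of_lt (by omega)
    have hsumT : 5 * n ∣ 5 + u * (u₀ * y₂) + u * (u₀ * y₃) := by
      have h : 5 * n ∣ u * (5 * (u₀ * k)) + (u * (u₀ * y₂) + u * (u₀ * y₃)) := by
        rw [← mul_add, ← mul_add, ← add_assoc]; exact Dvd.dvd.mul_left hsum' u
      have e : 5 + (u * (u₀ * y₂) + u * (u₀ * y₃))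
          ≡ u * (5 * (u₀ * k)) + (u * (u₀ * y₂) + u * (u₀ * y₃)) [MOD 5 * n] :=
        hu5.symm.add_right _
      rw [add_assoc]
      exact Nat.modEq_zero_iff_dvd.mp (e.trans (Nat.modEq_zero_iff_dvd.mpr h))
    have hsumT' : 5 * n ∣ 5 * u + u * (u₀ * x₂) + u * (u₀ * x₃) := by
      rw [Nat.mul_comm 5 u, ← mul_add, ← mul_add]
      exact Dvd.dvd.mul_left hsum u
    exact half_case n u (u * (u₀ * y₂)) (u * (u₀ * y₃)) (u * (u₀ * x₂)) (u * (u₀ * x₃)) hn h5n h2n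
      hsumT (five_nd h5u h5s') (five_nd h5u h5t') hun hsumT' (five_nd h5u h5s) (five_nd h5u h5t) hw' hT
  · -- `w = 2⁻¹`
    exact half_case n (u₀ * k) (u₀ * x₂) (u₀ * x₃) (u₀ * y₂) (u₀ * y₃) hn h5n h2n hsum h5s h5t hy'
      hsum' h5s' h5t' hw hS

/-- **COROLLARY (the prime 5, unit cofactor; PROPOSITIONS L5 + Z5 = Koblitz–Rohrlich's Cases 3 and 2 at `p = 5 ∥ N`).**
`N = 5n`, `n > 20`, `gcd(n, 30) = 1`.  A triple `T = (x₁, x₂, x₃)` of level `N` with `5 ∣ x₁`, `gcd(x₁, n) = 1`,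
`5 ∤ x₂ x₃` shares its CM type with no triple `T' = (y₁, y₂, y₃)` of level `N` with `5 ∤ y₂ y₃` and either `5 ∤ y₁`
(pattern U) or `gcd(y₁, n) = 1` and `y₁ ≢ x₁ (mod N)` (pattern Z1 with unit cofactor, not a rearrangement of `T` at
the entry divisible by 5). -/
theorem Z1_unit_rigid (n x₁ x₂ x₃ y₁ y₂ y₃ : ℕ) (hn : 20 < n) (hn30 : Nat.Coprime n 30)
    (hX : 5 * n ∣ x₁ + x₂ + x₃) (hx₁ : 5 ∣ x₁) (hx₁n : Nat.Coprime x₁ n) (hx₂ : ¬ 5 ∣ x₂) (hx₃ : ¬ 5 ∣ x₃)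
    (hY : 5 * n ∣ y₁ + y₂ + y₃) (hy₂ : ¬ 5 ∣ y₂) (hy₃ : ¬ 5 ∣ y₃)
    (hy₁ : ¬ 5 ∣ y₁ ∨ (Nat.Coprime y₁ n ∧ ¬ x₁ ≡ y₁ [MOD 5 * n]))
    (hH : SameType (5 * n) (x₁, x₂, x₃) (y₁, y₂, y₃)) : False := by
  have hc5 : Nat.Coprime 5 n := (Nat.Coprime.coprime_dvd_right (by norm_num : 5 ∣ 30) hn30).symm
  have h5n : ¬ 5 ∣ n := (Nat.Prime.coprime_iff_not_dvd Nat.prime_five).mp hc5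
  by_cases h5 : 5 ∣ y₁
  · rcases hy₁ with h | ⟨hy₁n, hne⟩
    · exact h h5
    · exact propZ5 n x₁ x₂ x₃ y₁ y₂ y₃ hn hn30 hX hx₁ hx₁n hx₂ hx₃ hY h5 hy₁n hy₂ hy₃ hne hH
  · exact propL5 n x₁ x₂ x₃ y₁ y₂ y₃ hn h5n hX hx₁ hx₁n hx₂ hx₃ hY h5 hy₂ hy₃ hH

/-! ## Kernel instances (not used): `N = 385 = 5·77` -/

/-- `one_two_not_inH` and the first residue `(N + 5)/2 = 195 = 5·39`, `39 = 2⁻¹ mod 77`, at `N = 385`: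
`1, 2 ∉ H_T` for `T = (5, 384, 381)`; `⟨2·195⟩₃₈₅ = 5` -/
example : ¬ InH 385 (5, 384, 381) 1 ∧ ¬ InH 385 (5, 384, 381) 2 ∧ 2 * 195 % 385 = 5 ∧ 2 * 39 % 77 = 1 := by
  unfold InH; decide

/-- the summed identity behind `pair_sum` at `n = 77`, `t₀ = 1`, for the Z1 triple `T = (5·39, 1, 189)` (level 385,
`195 + 1 + 189 = 385`): total residue sum over the five lifts of `1̄` equals `25⟨39⟩ + 5⟨1⟩ + 5⟨189 mod 77⟩ + 20·77` -/
example : ((List.range 5).map fun j => rsum 385 (5 * 39, 1, 189) (1 + j * 77)).sum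
    = 25 * (1 * 39 % 77) + 5 * (1 * 1 % 77) + 5 * (1 * 189 % 77) + 20 * 77 := by
  unfold rsum; decide

#print axioms propZ5
#print axioms Z1_unit_rigid

end HodgeFermat.KRFree.PropZ5
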